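import Summits.BirchSwinnertonDyer.Rank1Residual.X11b.CW53CompositeOfFrames
import Literature.NumberTheory.EllipticCurves.PAdicGrossZagierConstantTermProofs
import HarnessLib

/-!
# The two TYPED theorems "Castella–Wan 2024 Thm. 5.3" and "Castella 2018 Thm. 3.2" in valuations:
# the one-sided bound on the constant term of every generator of `char_Λ(X_{∅,𝔭̄})`
# (cell `bsd-print-x6`, prover p3 «anticyclotomic road»; consumer of ty1's `X11b.exists_constantCoeff_eq_mul_sq_of_thm53_of_thm32`)

HONEST FRAMING. Cell `bsd-print-x6` (HOME `run/shared/lean/pub/bsd-print-x6/`, D-0131 (2) PRINT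
TIER). THEOREM ONLY; nothing asserted about any curve; nothing booked; PARTITION: 0 cells move.
The seat's statement-only composite `castellaWan2024_thm53_castella2018_thm32_constantCoeff` (p543331,
pack conjunct (10) of `Supersingular.PublishedAcInputsX6Err`) carries the interpretive flag
`CW24-Cas18-LBDP-identification@CH18`. ty1's KERNEL THEOREMS remove it on the good-supersingular slice:
`X11b.norm_coe_constantCoeff_eq_of_isCWBDPLFunction_of_isBDPLFunction` (p547864: `‖L_W(𝟙)‖ = ‖L_C(𝟙)‖`
across the two frames, `p ∤ 2 N d_K`) and `X11b.exists_constantCoeff_eq_mul_sq_of_thm53_of_thm32`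
(p548997: from the typed Thm. 5.3 `CastellaWan2024.thm53_exists_isCWBDPLFunction_charIdeal_map_le` and
the typed Thm. 3.2 `Castella2018.thm32_exists_isBDPLFunction_valueAtOne`, for a generator `F` of
`char_Λ(X_{∅, vbar})`: `F(0) = e · ((1 − a_p p⁻¹ + p⁻¹) · log_{ω_E} P_K)²`, `e ∈ ℤ_p`). This file is the
seat's valuation consumer `le_valuation_constantCoeff_of_thm53thm32` re-run on that theorem:
`2·(ord_p(1 − a_p + p) − 1 + ord_p log_{ω_E} P_K) ≤ ord_p 𝓖(0)` for every generator with `𝓖(0) ≠ 0` —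
the input of the seat's (IMC≥∘BDP)ᵍ discharge. Letters: `GoodSS W p` (Thm. 5.3's typing), the
parametrisation datum at level `N_E`, the Heegner relation at an infinite place `w` (Thm. 3.2's letter).
Flags that remain belong to the typed theorems (`CW24-CLW22-addendum`, `Hid04-gap`,
`CW24-53-XrelstrReading`; `Cas18-Thm32-parametrisation-via-(3.2)`).

References: [CastellaWan2023] Prop. 2.1 (MS p. 6), Thm. 5.3 (pp. 23–24); [Castella2018] Thm. 3.1–3.2
(arXiv:1704.06608 p. 9); [CastellaHsieh2018] Thm. A.
-/

set_option linter.dupNamespace false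
set_option autoImplicit false

noncomputable section

open scoped Classical

open WeierstrassCurve NumberField IsDedekindDomain Field Literature.NumberTheory.EllipticCurves
  Literature.NumberTheory.EllipticCurves.ModularForms
  Literature.NumberTheory.EllipticCurves.Rank1Residual
  Literature.NumberTheory.EllipticCurves.Castella2018
  Summit.BirchSwinnertonDyer.Rank1Residual

namespace Summit.BirchSwinnertonDyer.BirchSwinnertonDyer.Theorems.AnticyclotomicRankZero

/-! ### §0 Valuation bookkeeping (private copy of the seat's helper) -/

section Valuation

variable {p : ℕ} [hp : Fact p.Prime]

/-- `ord_p` of the right-hand side of the composite: for `e ∈ ℤ_p`, an integer `a`, `L ∈ ℚ_p` and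
`m ∈ ℕ`, if `e · ((1 − a p⁻¹ + p⁻¹) · (L/m))² ≠ 0` then its valuation is
`ord_p e + 2·(ord_p(1 − a + p) − 1 + (ord_p L − ord_p m))` (additivity of `ord_p`;
`1 − a p⁻¹ + p⁻¹ = (1 − a + p)/p`). Private helper. [folklore] -/
private theorem valuation_int_mul_bdpShape' (e : ℤ_[p]) (a : ℤ) (L : ℚ_[p]) (m : ℕ)
    (h : (e : ℚ_[p]) * ((1 - (a : ℚ_[p]) * (p : ℚ_[p])⁻¹ + (p : ℚ_[p])⁻¹) * (L / (m : ℚ_[p]))) ^ 2 ≠ 0) :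
    ((e : ℚ_[p]) * ((1 - (a : ℚ_[p]) * (p : ℚ_[p])⁻¹ + (p : ℚ_[p])⁻¹) * (L / (m : ℚ_[p]))) ^ 2).valuation =
      ((e : ℚ_[p]).valuation : ℤ) +
        2 * ((padicValInt p (1 - a + p) : ℤ) - 1 + (L.valuation - (padicValNat p m : ℤ))) := by
  have hp0 : (p : ℚ_[p]) ≠ 0 := by exact_mod_cast hp.out.ne_zero
  have he0 : (e : ℚ_[p]) ≠ 0 := by
    intro h0; apply h; rw [h0]; ring
  have hA0 : (1 - (a : ℚ_[p]) * (p : ℚ_[p])⁻¹ + (p : ℚ_[p])⁻¹) ≠ 0 := by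
    intro h0; apply h; rw [h0]; ring
  have hLm0 : L / (m : ℚ_[p]) ≠ 0 := by
    intro h0; apply h; rw [h0]; ring
  have hL0 : L ≠ 0 := by
    intro h0; apply hLm0; rw [h0, zero_div]
  have hm0 : (m : ℚ_[p]) ≠ 0 := by
    intro h0; apply hLm0; rw [h0, div_zero]
  have hAeq : (1 - (a : ℚ_[p]) * (p : ℚ_[p])⁻¹ + (p : ℚ_[p])⁻¹) =
      ((1 - a + p : ℤ) : ℚ_[p]) * (p : ℚ_[p])⁻¹ := by
    push_cast
    field_simp
    ring
  have hA1 : ((1 - a + p : ℤ) : ℚ_[p]) ≠ 0 := by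
    intro h0; apply hA0; rw [hAeq, h0, zero_mul]
  have hvA : (1 - (a : ℚ_[p]) * (p : ℚ_[p])⁻¹ + (p : ℚ_[p])⁻¹).valuation =
      (padicValInt p (1 - a + p) : ℤ) - 1 := by
    rw [hAeq, Padic.valuation_mul hA1 (inv_ne_zero hp0), Padic.valuation_intCast,
      Padic.valuation_inv, Padic.valuation_p]
    ring
  have hvL : (L / (m : ℚ_[p])).valuation = L.valuation - (padicValNat p m : ℤ) := by
    rw [div_eq_mul_inv, Padic.valuation_mul hL0 (inv_ne_zero hm0), Padic.valuation_inv,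
      Padic.valuation_natCast]
    ring
  rw [Padic.valuation_mul he0 (pow_ne_zero 2 (mul_ne_zero hA0 hLm0)), Padic.valuation_pow,
    Padic.valuation_mul hA0 hLm0, hvA, hvL]
  ring

end Valuation

/-! ### §1 In valuations: the one-sided bound for every generator, from the two typed theorems -/

section Consumer

variable {W : WeierstrassCurve ℚ} [W.IsElliptic] [W.IsGloballyMinimal] {p : ℕ} [Fact p.Prime]
  {K : Type} [Field K] [NumberField K]

/-- **The two typed theorems in valuations, as a ONE-SIDED bound on the good-supersingular slice**:
for EVERY generator `𝓖` of `ch_Λ(X)` (strict at `vbar`) with `𝓖(0) ≠ 0`,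
`2·(ord_p(1 − a_p + p) − 1 + ord_p log_{ω_E} P_K) ≤ ord_p 𝓖(0)` — the seat's
`le_valuation_constantCoeff_of_thm53thm32` with the composite fact replaced by
`exists_intMul_constantCoeff_of_thm53_of_thm32` (typed Thm. 5.3 + typed Thm. 3.2 + rigidity).
[cite: CastellaWan2023, Thm. 5.3 (MS pp. 23–24)] [cite: Castella2018, Thm. 3.2 (arXiv:1704.06608 p. 9)] -/
theorem le_valuation_constantCoeff_of_thm53typed_of_thm32
    (h53 : CastellaWan2024.thm53_exists_isCWBDPLFunction_charIdeal_map_le)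
    (h32 : Castella2018.thm32_exists_isBDPLFunction_valueAtOne)
    (hp : 5 ≤ p) (hss : GoodSS W p) (hsst : Semistable W) (hirr : Irr W p)
    (hK : IsImaginaryQuadratic K)
    (hHeeg : ∀ ℓ : ℕ, ℓ.Prime → ℓ ∣ W.conductorNorm ℤ →
      ∃ v : HeightOneSpectrum (𝓞 K), Ideal.absNorm v.asIdeal = ℓ)
    (hii : ∃ ℓ : ℕ, ℓ.Prime ∧ ℓ ∣ W.conductorNorm ℤ ∧
      ((Ideal.span {(ℓ : ℤ)}).primesOver (𝓞 K)).ncard ≠ 2)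
    (hiii : ¬ 2 ∣ W.conductorNorm ℤ → ((Ideal.span {(2 : ℤ)}).primesOver (𝓞 K)).ncard = 2)
    (hHp : SatisfiesHeegnerHypothesis p K)
    (ι : K →+* ℚ_[p]) (v vbar : HeightOneSpectrum (𝓞 K))
    (hv : ∀ x : 𝓞 K, x ∈ v.asIdeal ↔ ‖ι (x : K)‖ < 1)
    (hvbar : ((p : ℕ) : 𝓞 K) ∈ vbar.asIdeal) (hne : vbar ≠ v)
    (κ : ZpExtension K p) (hκ : κ.IsAnticyclotomic)
    (γ : absoluteGaloisGroup K) [Fact (κ.IsTopGenerator γ)]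
    [NeZero (W.conductorNorm ℤ)] (Dt : ModularParametrizationData W (W.conductorNorm ℤ))
    (hc : ¬ (p : ℤ) ∣ Dt.c) (H : HeegnerDatum (W.conductorNorm ℤ) (NumberField.discr K))
    (w : InfinitePlace K) (P : (W.baseChange K).toAffine.Point)
    (hP : WeierstrassCurve.Affine.Point.map w.embedding.toRatAlgHom P = heegnerPointComplex Dt H)
    (G : IwasawaAlgebra p) (hG : AcSelmer.XAc.charIdeal (W.baseChange K) p κ vbar ∅ γ = Ideal.span {G})
    (hG0 : PowerSeries.constantCoeff G ≠ 0) :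
    2 * ((padicValInt p (1 - W.frobeniusTrace p + p) : ℤ) - 1 +
        Literature.NumberTheory.EllipticCurves.padicLogOrd W p ι P) ≤
      ((PowerSeries.constantCoeff G).valuation : ℤ) := by
  obtain ⟨e, he⟩ := X11b.exists_constantCoeff_eq_mul_sq_of_thm53_of_thm32 h53 h32 hp hss hsst hirr hK
    hHeeg hii hiii hHp ι v vbar hv hvbar hne κ hκ γ Dt hc H w P hP G hG
  simp only [padicLogOmega] at he
  have hrhs : (e : ℚ_[p]) *
      ((1 - (W.frobeniusTrace p : ℚ_[p]) * (p : ℚ_[p])⁻¹ + (p : ℚ_[p])⁻¹) *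
        ((W.baseChange ℚ_[p]).padicLogPoint (formalIndex W p • padicPointOf W p ι P) /
          (formalIndex W p : ℚ_[p]))) ^ 2 ≠ 0 := by
    rw [← he]
    exact PadicInt.coe_ne_zero.2 hG0
  have hval := congrArg Padic.valuation he
  rw [PadicInt.valuation_coe, valuation_int_mul_bdpShape' e (W.frobeniusTrace p) _ _ hrhs] at hval
  have he0 : (0 : ℤ) ≤ ((e : ℚ_[p]).valuation : ℤ) := PadicInt.valuation_coe_nonneg
  rw [Literature.NumberTheory.EllipticCurves.padicLogOrd]
  omega

end Consumer

end Summit.BirchSwinnertonDyer.BirchSwinnertonDyer.Theorems.AnticyclotomicRankZero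

end
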